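import Summits.HodgeConjecture.HodgeConjecture.Theses.GenericDivisibility
import Literature.AlgebraicGeometry.Motives.UnramifiedCohomology
import Literature.AlgebraicGeometry.Motives.BettiCycleClassFiniteProofs
import Mathlib.RingTheory.Filtration
import HarnessLib

/-!
# Route GenericDivisibility — crux `HodgeClassesGenericallyDivisible` (stmt-HodgeConjecture-18466), line `Sketch`: stub `stub_onePrimePrinciple`

Registered stub 4 of the lead's skeleton `Cruxes/HodgeClassesGenericallyDivisible/Lines/Sketch.lean`
(the ONE-PRIME PRINCIPLE, diagnostic lemma (P-L2)/(O-L1)): on a smooth projective `X/ℂ`, if an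
integral class `z ∈ H^q(X(ℂ); ℤ)` is, for every `k`, congruent modulo `ℓᵏ · H` to a class of
integral coniveau `≥ 1`, then some multiple `N • z`, `N ≥ 1` prime to `ℓ`, has integral coniveau
`≥ 1`.

Pure algebra in the finitely generated abelian group `H = H^q(X(ℂ); ℤ)` (tree theorem
`bettiCohomologyInt_finite_holds`): in `Q = H / N¹`, the class `z̄` of `z` lies in `⋂ₖ ℓᵏ Q`, so by
Krull's intersection theorem for the ideal `(ℓ)` of `ℤ` on the finitely generated `ℤ`-module `Q`
(Mathlib `Ideal.mem_iInf_smul_pow_eq_bot_iff`) `r z̄ = z̄` for some `r ∈ (ℓ)`; then `N = |1 - r|`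
is `≥ 1`, prime to `ℓ`, and `N z̄ = 0`. Reference: Hatcher, *Algebraic Topology* (2002), Cor. A.9
and §3.1 (finitely generated abelian groups); Atiyah–Macdonald Cor. 10.19 (Krull).
-/

noncomputable section

-- every declaration of this problem lives in `Summit.HodgeConjecture.HodgeConjecture.…` (summit = sub-problem)
set_option linter.dupNamespace false

open CategoryTheory AlgebraicGeometry
open Literature.AlgebraicGeometry.Motives Literature.AlgebraicGeometry.HodgeTheory
  Literature.AlgebraicTopology.SingularHomology

namespace Summit.HodgeConjecture.HodgeConjecture.Theorems

/-- **`⋂ₖ (S + ℓᵏ M)` lies in the prime-to-`ℓ` saturation of `S`, finitely generated case.** In a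
finitely generated abelian group `M` (with its canonical `ℤ`-module structure), if
`z ≡ yₖ (mod ℓᵏ M)` with `yₖ ∈ S` for every `k` (`ℓ` prime), then `N • z ∈ S` for some `N ≥ 1`
prime to `ℓ`: by Krull's intersection theorem for the ideal `(ℓ)` of `ℤ` on the finitely generated
`ℤ`-module `M/S` (Mathlib `Ideal.mem_iInf_smul_pow_eq_bot_iff`), `z̄ ∈ ⋂ₖ ℓᵏ (M/S)` gives
`r • z̄ = z̄` for some `r ∈ (ℓ)`, so `N = |1 - r|` works. [cite: HatcherAT2002, Cor. A.9] -/
theorem genericDivisibility_exists_coprime_nsmul_mem {M : Type} [AddCommGroup M] [Module.Finite ℤ M]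
    (S : AddSubgroup M) {ℓ : ℕ} (hℓ : ℓ.Prime) {z : M}
    (hz : ∀ k : ℕ, ∃ y ∈ S, ∃ w : M, z = y + (ℓ ^ k) • w) :
    ∃ N : ℕ, 1 ≤ N ∧ N.Coprime ℓ ∧ N • z ∈ S := by
  let S' : Submodule ℤ M := AddSubgroup.toIntSubmodule S
  letI : Module ℤ (M ⧸ S') := Submodule.Quotient.module S'
  haveI : Module.Finite ℤ (M ⧸ S') := Module.Finite.quotient ℤ S'
  let I : Ideal ℤ := Ideal.span {(ℓ : ℤ)}
  -- the class of `z` is `ℓᵏ`-divisible in `M/S` for every `k`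
  have hq : Submodule.Quotient.mk (p := S') z ∈ (⨅ i : ℕ, I ^ i • ⊤ : Submodule ℤ (M ⧸ S')) := by
    refine (Submodule.mem_iInf _).2 fun i ↦ ?_
    obtain ⟨y, hy, w, hzw⟩ := hz i
    have hzw' : Submodule.Quotient.mk (p := S') z =
        Submodule.Quotient.mk (p := S') (((ℓ : ℤ) ^ i) • w) := by
      rw [eq_comm, ← sub_eq_zero, ← Submodule.Quotient.mk_sub, Submodule.Quotient.mk_eq_zero]
      change (ℓ : ℤ) ^ i • w - z ∈ S
      have e : (ℓ : ℤ) ^ i • w - z = -y := by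
        rw [← Int.natCast_pow, natCast_zsmul, hzw]
        abel
      rw [e]
      exact S.neg_mem hy
    rw [hzw', Submodule.Quotient.mk_smul]
    exact Submodule.smul_mem_smul (Ideal.pow_mem_pow (Ideal.mem_span_singleton_self _) _)
      Submodule.mem_top
  -- Krull: `r • z̄ = z̄` for some `r ∈ (ℓ)`, i.e. `(1 - r) • z ∈ S`
  obtain ⟨r, hr⟩ := (Ideal.mem_iInf_smul_pow_eq_bot_iff I _).1 hq
  obtain ⟨s, hs⟩ := Ideal.mem_span_singleton'.1 r.2
  have hmem : (1 - (r : ℤ)) • z ∈ S := by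
    change (1 - (r : ℤ)) • z ∈ S'
    rw [sub_smul, one_smul, ← Submodule.Quotient.mk_eq_zero, Submodule.Quotient.mk_sub,
      Submodule.Quotient.mk_smul]
    exact sub_eq_zero.2 hr.symm
  set N : ℕ := (1 - (r : ℤ)).natAbs with hN
  have hcop : IsCoprime (1 - (r : ℤ)) (ℓ : ℤ) := ⟨1, s, by rw [← hs]; ring⟩
  refine ⟨N, ?_, ?_, ?_⟩
  · -- `1 - r ≠ 0`: otherwise `ℓ ∣ 1`
    rw [Nat.one_le_iff_ne_zero, hN, ne_eq, Int.natAbs_eq_zero, sub_eq_zero]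
    intro h1
    have hdvd : (ℓ : ℤ) ∣ 1 := ⟨s, by rw [h1, ← hs, mul_comm]⟩
    exact hℓ.ne_one (Nat.dvd_one.1 (Int.natCast_dvd_natCast.1 hdvd))
  · -- `gcd (|1 - r|, ℓ) = 1`
    have h := Int.isCoprime_iff_gcd_eq_one.1 hcop
    rwa [Int.gcd_eq_natAbs, Int.natAbs_natCast] at h
  · rcases Int.natAbs_eq (1 - (r : ℤ)) with h | h
    · rw [← hN] at h
      rw [← natCast_zsmul, ← h]
      exact hmem
    · rw [← hN] at h
      rw [h, neg_smul, natCast_zsmul, neg_mem_iff] at hmem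
      exact hmem

/-- **Stub 4 of line `Sketch` (crux C1): the one-prime principle.** On a smooth projective `X/ℂ`,
if an integral class `z ∈ H^q(X(ℂ); ℤ)` is, for every `k`, congruent modulo `ℓᵏ · H^q(X(ℂ); ℤ)`
to a class of integral coniveau `≥ 1` (`ℓ` prime), then `N • z ∈ N¹ H^q(X(ℂ); ℤ)` for some `N ≥ 1`
prime to `ℓ`: `H^q(X(ℂ); ℤ)` is finitely generated (`bettiCohomologyInt_finite_holds`) and in the
finitely generated quotient `H / N¹` one has `⋂ₖ ℓᵏ (H/N¹) =` the prime-to-`ℓ` torsion.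
[cite: HatcherAT2002, Cor. A.9 and §3.1] -/
theorem stub_onePrimePrinciple : ∀ ⦃n : ℕ⦄ ⦃X : SchemeOver ℂ⦄, IsSmoothProjective n X →
    ∀ (q : ℕ) (z : singularCohomology ℤ ℤ (ComplexPoints X) q) (ℓ : ℕ), ℓ.Prime →
      (∀ k : ℕ, ∃ y ∈ coniveauFiltration ℤ X q 1,
        ∃ w : singularCohomology ℤ ℤ (ComplexPoints X) q, z = y + (ℓ ^ k) • w) →
      ∃ N : ℕ, 1 ≤ N ∧ N.Coprime ℓ ∧ N • z ∈ coniveauFiltration ℤ X q 1 := by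
  intro n X hX q z ℓ hℓ hz
  -- finite generation, transported to the canonical `ℤ`-module structure of the abelian group
  -- `H^q(X(ℂ); ℤ)` (all `ℤ`-module structures on an abelian group coincide)
  haveI : @Module.Finite ℤ (singularCohomology ℤ ℤ (ComplexPoints X) q) _ _
      (AddCommGroup.toIntModule _) := by
    convert bettiCohomologyInt_finite_holds hX q
    exact Subsingleton.elim _ _
  exact genericDivisibility_exists_coprime_nsmul_mem
    (coniveauFiltration ℤ X q 1).toAddSubgroup hℓ hz

end Summit.HodgeConjecture.HodgeConjecture.Theorems

end
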